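import Summits.QuantumFields.YangMills.Theorems.TunedSequenceExists.Negative.Freezing
import Summits.QuantumFields.YangMills.Theorems.ParabolicTrajectoryTunedSequenceExistsSplitDefs
import Literature.MathematicalPhysics.QuantumLattice.LatticeGaugeDLRCovarianceSplit

/-!
# `TunedSequenceExists` (stmt-QuantumFields-10524), line `fixed-aspect-window`:
# freezing of the Wilson theory UNIFORMLY IN THE VOLUME — the mean action (part 1 of 2)

Helper file of the line lead (seat c4, `--supports stmt-QuantumFields-10524`), the (V)-side
(`stub_volumeMonotone`) provable content.  `Negative/Freezing.lean` freezes the Wilson theory on a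
FIXED torus (Laplace's method on that torus's compact configuration space — constants depend on
the side `S`).  This file and its sequel `…UniformFreezing` reach the same endpoint with constants
INDEPENDENT of `S`, for every compact group `G` and every continuous unitary representation `ρ`.
Part 1 (here):

* `exp_integral_le_integral_exp` — `exp(∫ f) ≤ ∫ exp f` on a probability space (from
  `x + 1 ≤ eˣ`);
* `integral_wilsonAction_le` — for `β > 0` and a measurable set `Good` of configurations of the
  torus of side `S` on which the Wilson action is `≤ w₀`:
  `∫ S_W dμ_{β,S} ≤ 2 w₀ + (2/β) log(1 / Haar^{E}(Good))`
  (`exp(β E_β[S_W]/2) ≤ E_β[exp(β S_W/2)] = Z(β/2)/Z(β) ≤ 1/Z(β)` and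
  `Z(β) ≥ e^{-β w₀} Haar^{E}(Good)`);
* `exists_nhds_plaquetteDeficit_lt` — an open `V ∋ 1` with `N − Re tr ρ(a b c⁻¹ d⁻¹) < η` for
  `a, b, c, d ∈ V`;
* `integral_wilsonAction_eq_card_mul` — translation invariance:
  `∫ S_W dμ_{β,S} = |Λ_S| · ∫ (c_N − P(Ũ)) dμ_{β,S}`, `P = actionDensity ρ` the corner action
  density, `Ũ = torusLift S U`, `c_N = Σ_{i<j} N` (a local notation, not a definition).

Part 2 (`…UniformFreezing`) takes `Good = V^{E}` (`log(1/Haar^{E}(Good)) = 4S⁴ log(1/Haar V)`,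
`w₀ = 6 S⁴ η`) to get `sup_S ∫ (c_N − P) dμ_{β,S} → 0`, then `sup_{S,n} |⟨P ; τ_n P⟩_{β,S}| → 0`,
and the consequences for the registered stub (V).

References: K. Osterwalder, E. Seiler, Ann. Phys. 110 (1978) §2 (Wilson's lattice measure);
S. Chatterjee, J. Funct. Anal. 271 (2016) §7 (free-energy lower bounds by small balls, there for
`U(N)` on cubes; the soft torus / compact-`G` form is folklore).
-/

noncomputable section

open Filter Topology MeasureTheory
open Literature.MathematicalPhysics.QuantumFieldTheory Literature.MathematicalPhysics.QuantumLattice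
open Summit.QuantumFields.YangMills.Theorems.TunedSequenceExists.Negative.Freezing

namespace Summit.QuantumFields.YangMills.Theorems.TunedSequenceExists.UniformFreezing

/-! ## An elementary Jensen inequality -/

section Jensen

variable {X : Type*} [MeasurableSpace X]

/-- `exp (∫ f) ≤ ∫ exp f` on a probability space, for bounded measurable `f`
(from `x + 1 ≤ exp x` at `x = f − ∫ f`). [folklore] -/
theorem exp_integral_le_integral_exp (μ : Measure X) [IsProbabilityMeasure μ] {f : X → ℝ}
    (hf : Measurable f) (hfb : ∃ C : ℝ, ∀ x, |f x| ≤ C) :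
    Real.exp (∫ x, f x ∂μ) ≤ ∫ x, Real.exp (f x) ∂μ := by
  obtain ⟨C, hC⟩ := hfb
  set a : ℝ := ∫ x, f x ∂μ with ha
  have hfi : Integrable f μ := Integrable.of_bound hf.aestronglyMeasurable C
    (ae_of_all _ fun x => by rw [Real.norm_eq_abs]; exact hC x)
  have hei : Integrable (fun x => Real.exp (f x)) μ := by
    refine Integrable.of_bound (Real.measurable_exp.comp hf).aestronglyMeasurable (Real.exp C)
      (ae_of_all _ fun x => ?_)
    rw [Real.norm_eq_abs, abs_of_pos (Real.exp_pos _)]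
    exact Real.exp_le_exp.2 (le_of_abs_le (hC x))
  have hpt : ∀ x, Real.exp a * (f x - a + 1) ≤ Real.exp (f x) := fun x => by
    have h1 : f x - a + 1 ≤ Real.exp (f x - a) := Real.add_one_le_exp _
    calc Real.exp a * (f x - a + 1) ≤ Real.exp a * Real.exp (f x - a) :=
          mul_le_mul_of_nonneg_left h1 (Real.exp_pos _).le
      _ = Real.exp (f x) := by rw [← Real.exp_add]; ring_nf
  have hfa : Integrable (fun x => f x - a) μ := hfi.sub (integrable_const a)
  have hfa1 : Integrable (fun x => f x - a + 1) μ := hfa.add (integrable_const 1)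
  have hone : ∫ x, (f x - a + 1) ∂μ = 1 := by
    rw [integral_add hfa (integrable_const 1), integral_sub hfi (integrable_const a)]
    simp [ha]
  have hlin : ∫ x, Real.exp a * (f x - a + 1) ∂μ = Real.exp a := by
    rw [integral_const_mul, hone, mul_one]
  calc Real.exp a = ∫ x, Real.exp a * (f x - a + 1) ∂μ := hlin.symm
    _ ≤ ∫ x, Real.exp (f x) ∂μ := integral_mono (hfa1.const_mul _) hei hpt

end Jensen

/-! ## Gibbs means of the action: the volume-free bound -/

section Torus

variable {G : Type} [Group G] [TopologicalSpace G] [IsTopologicalGroup G] [CompactSpace G]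
  [MeasurableSpace G] [BorelSpace G] {N : ℕ}

omit [MeasurableSpace G] [BorelSpace G] in
/-- The normalised Haar measure of a compact group is a probability measure. [folklore] -/
theorem isProbabilityMeasure_haarProbability [MeasurableSpace G] [BorelSpace G] :
    IsProbabilityMeasure (haarProbability G) := by
  unfold haarProbability
  exact ⟨by simpa using Measure.haarMeasure_self (G := G) (K₀ := ⊤)⟩

/-- **Volume-free bound on the mean Wilson action.** On the torus of side `S`, for `β > 0`, a
continuous `ρ` with `Re tr ρ ≤ N`, and a measurable set `Good` of positive product-Haar measure on
which the Wilson action is at most `w₀`: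
`∫ S_W dμ_{β,S} ≤ 2 w₀ + (2/β) · log (1 / Haar^{E}(Good))`. [folklore] -/
theorem integral_wilsonAction_le [SecondCountableTopology G] {S : ℕ} [NeZero S]
    (ρ : G →* Matrix (Fin N) (Fin N) ℂ) (hρ : Continuous ρ) (hρN : ∀ g, (ρ g).trace.re ≤ N)
    {β : ℝ} (hβ : 0 < β) {Good : Set (GaugeConfig 4 S G)} (hGood : MeasurableSet Good)
    (hpos : 0 < (Measure.pi fun _ : Edge 4 S => haarProbability G).real Good) {w₀ : ℝ}
    (hw : ∀ U ∈ Good, wilsonAction ρ U ≤ w₀) :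
    ∫ U, wilsonAction ρ U ∂(wilsonMeasure (d := 4) (L := S) ρ β) ≤
      2 * w₀ + 2 / β * Real.log (1 / (Measure.pi fun _ : Edge 4 S => haarProbability G).real Good) := by
  haveI : IsProbabilityMeasure (haarProbability G) := isProbabilityMeasure_haarProbability
  set π : Measure (GaugeConfig 4 S G) := Measure.pi fun _ : Edge 4 S => haarProbability G with hπ
  haveI : IsProbabilityMeasure π := by rw [hπ]; infer_instance
  haveI := isProbabilityMeasure_wilsonMeasure (d := 4) (L := S) ρ hρ β
  set W : GaugeConfig 4 S G → ℝ := wilsonAction ρ with hW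
  have hWm : Measurable W := measurable_wilsonAction ρ hρ
  have hW0 : ∀ U, 0 ≤ W U := wilsonAction_nonneg ρ hρN
  obtain ⟨B, hB⟩ := exists_abs_wilsonAction_le (d := 4) (L := S) ρ hρ
  -- partition functions
  set Z : ℝ → ℝ := fun b => ∫ U, Real.exp (-b * W U) ∂π with hZ
  have hexp_int : ∀ b : ℝ, Integrable (fun U => Real.exp (-b * W U)) π := fun b => by
    refine Integrable.of_bound ((Real.measurable_exp.comp (hWm.const_mul _)).aestronglyMeasurable)
      (Real.exp (|b| * B)) (ae_of_all _ fun U => ?_)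
    rw [Real.norm_eq_abs, abs_of_pos (Real.exp_pos _)]
    refine Real.exp_le_exp.2 ?_
    have h1 : -b * W U ≤ |b * W U| := by rw [neg_mul]; exact neg_le_abs _
    have h2 : |b * W U| ≤ |b| * B := by rw [abs_mul]; exact mul_le_mul_of_nonneg_left (hB U) (abs_nonneg _)
    linarith
  have hZpos : ∀ b : ℝ, 0 < Z b := fun b => by
    simp only [hZ]
    have h : Real.exp (-(|b| * B)) * π.real Set.univ ≤ ∫ U, Real.exp (-b * W U) ∂π := by
      calc Real.exp (-(|b| * B)) * π.real Set.univ = ∫ _U, Real.exp (-(|b| * B)) ∂π := by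
            rw [integral_const, smul_eq_mul, mul_comm]
        _ ≤ ∫ U, Real.exp (-b * W U) ∂π := by
            refine integral_mono (integrable_const _) (hexp_int b) fun U => Real.exp_le_exp.2 ?_
            have h1 : -(b * W U) ≥ -|b * W U| := neg_le_neg (le_abs_self _)
            have h2 : |b * W U| ≤ |b| * B := by
              rw [abs_mul]; exact mul_le_mul_of_nonneg_left (hB U) (abs_nonneg _)
            show -(|b| * B) ≤ -b * W U
            rw [neg_mul]; linarith
    refine lt_of_lt_of_le ?_ h
    have : π.real Set.univ = 1 := by simp
    rw [this, mul_one]; exact Real.exp_pos _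
  -- (Z1) `Z(β/2) ≤ 1`
  have hZhalf : Z (β / 2) ≤ 1 := by
    simp only [hZ]
    calc ∫ U, Real.exp (-(β / 2) * W U) ∂π ≤ ∫ _U, (1 : ℝ) ∂π := by
          refine integral_mono (hexp_int _) (integrable_const _) fun U => ?_
          have : -(β / 2) * W U ≤ 0 := by nlinarith [hW0 U]
          simpa using Real.exp_le_exp.2 this |>.trans (le_of_eq Real.exp_zero)
      _ = 1 := by simp
  -- (Z2) `Z(β) ≥ e^{-β w₀} · π(Good)`
  have hZge : Real.exp (-β * w₀) * π.real Good ≤ Z β := by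
    simp only [hZ]
    calc Real.exp (-β * w₀) * π.real Good
        = ∫ U, Good.indicator (fun _ => Real.exp (-β * w₀)) U ∂π := by
          rw [integral_indicator_const _ hGood, smul_eq_mul, mul_comm]
      _ ≤ ∫ U, Real.exp (-β * W U) ∂π := by
          refine integral_mono ((integrable_const _).indicator hGood) (hexp_int β) fun U => ?_
          by_cases hU : U ∈ Good
          · rw [Set.indicator_of_mem hU]
            exact Real.exp_le_exp.2 (by nlinarith [hw U hU])
          · rw [Set.indicator_of_notMem hU]; exact (Real.exp_pos _).le
  -- Jensen: `exp(β/2 · E_β[W]) ≤ E_β[exp(β/2 · W)] = Z(β/2)/Z(β)`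
  have hJ : Real.exp (∫ U, β / 2 * W U ∂(wilsonMeasure (d := 4) (L := S) ρ β)) ≤
      ∫ U, Real.exp (β / 2 * W U) ∂(wilsonMeasure (d := 4) (L := S) ρ β) :=
    exp_integral_le_integral_exp _ (hWm.const_mul _)
      ⟨|β / 2| * B, fun U => by rw [abs_mul]; exact mul_le_mul_of_nonneg_left (hB U) (abs_nonneg _)⟩
  have hratio : ∫ U, Real.exp (β / 2 * W U) ∂(wilsonMeasure (d := 4) (L := S) ρ β) = Z (β / 2) / Z β := by
    rw [integral_wilsonMeasure_eq_div ρ hρ β]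
    simp only [hZ, hπ]
    congr 1
    refine integral_congr_ae (ae_of_all _ fun U => ?_)
    show Real.exp (β / 2 * W U) * Real.exp (-β * W U) = Real.exp (-(β / 2) * W U)
    rw [← Real.exp_add]; ring_nf
  have hkey : Real.exp (β / 2 * ∫ U, W U ∂(wilsonMeasure (d := 4) (L := S) ρ β)) ≤ 1 / Z β := by
    have h1 : ∫ U, β / 2 * W U ∂(wilsonMeasure (d := 4) (L := S) ρ β) = β / 2 * ∫ U, W U ∂(wilsonMeasure (d := 4) (L := S) ρ β) :=
      integral_const_mul _ _
    rw [← h1]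
    refine hJ.trans ?_
    rw [hratio]
    exact div_le_div_of_nonneg_right hZhalf (hZpos β).le
  -- logarithms
  have hlog1 : β / 2 * ∫ U, W U ∂(wilsonMeasure (d := 4) (L := S) ρ β) ≤ Real.log (1 / Z β) := by
    have := Real.log_le_log (Real.exp_pos _) hkey
    rwa [Real.log_exp] at this
  have hlog2 : Real.log (1 / Z β) ≤ β * w₀ + Real.log (1 / π.real Good) := by
    have hprod : 0 < Real.exp (-β * w₀) * π.real Good := mul_pos (Real.exp_pos _) hpos
    calc Real.log (1 / Z β) ≤ Real.log (1 / (Real.exp (-β * w₀) * π.real Good)) :=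
          Real.log_le_log (by have := hZpos β; positivity)
            (one_div_le_one_div_of_le hprod hZge)
      _ = β * w₀ + Real.log (1 / π.real Good) := by
          rw [one_div, mul_inv, Real.log_mul (inv_ne_zero (Real.exp_pos _).ne') (inv_ne_zero hpos.ne'),
            ← Real.exp_neg, Real.log_exp, one_div]
          ring
  have hfin : β / 2 * ∫ U, W U ∂(wilsonMeasure (d := 4) (L := S) ρ β) ≤ β * w₀ + Real.log (1 / π.real Good) :=
    hlog1.trans hlog2
  -- divide by `β/2`
  have hβ2 : 0 < β / 2 := by positivity
  calc ∫ U, W U ∂(wilsonMeasure (d := 4) (L := S) ρ β)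
      = (β / 2 * ∫ U, W U ∂(wilsonMeasure (d := 4) (L := S) ρ β)) / (β / 2) := by field_simp
    _ ≤ (β * w₀ + Real.log (1 / π.real Good)) / (β / 2) := div_le_div_of_nonneg_right hfin hβ2.le
    _ = 2 * w₀ + 2 / β * Real.log (1 / π.real Good) := by field_simp

omit [CompactSpace G] [BorelSpace G] in
/-- Plaquette holonomies of configurations on `ℤ⁴` are measurable in the configuration. [folklore] -/
theorem measurable_plaquetteHolonomyZd_zero [SecondCountableTopology G] [BorelSpace G] (i j : Fin 4) :
    Measurable fun W : LGConfig 4 G => plaquetteHolonomyZd W 0 i j := by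
  unfold plaquetteHolonomyZd
  fun_prop

/-! ## Small neighbourhoods of `1` and the good set -/

omit [CompactSpace G] [MeasurableSpace G] [BorelSpace G] in
/-- **Small plaquette deficits near the identity.** For a continuous representation `ρ` and `η > 0`
there is an open neighbourhood `V` of `1 ∈ G` such that `N − Re tr ρ(a b c⁻¹ d⁻¹) < η` whenever
`a, b, c, d ∈ V`. [folklore] -/
theorem exists_nhds_plaquetteDeficit_lt (ρ : G →* Matrix (Fin N) (Fin N) ℂ) (hρ : Continuous ρ)
    {η : ℝ} (hη : 0 < η) :
    ∃ V : Set G, IsOpen V ∧ (1 : G) ∈ V ∧ ∀ a b c d : G, a ∈ V → b ∈ V → c ∈ V → d ∈ V →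
      (N : ℝ) - (ρ (a * b * c⁻¹ * d⁻¹)).trace.re < η := by
  set φ : (Fin 4 → G) → ℝ := fun g => (N : ℝ) - (ρ (g 0 * g 1 * (g 2)⁻¹ * (g 3)⁻¹)).trace.re
    with hφ
  have hφc : Continuous φ := by
    refine continuous_const.sub ((continuous_trace_re ρ hρ).comp ?_)
    fun_prop
  have hs : IsOpen (φ ⁻¹' Set.Iio η) := hφc.isOpen_preimage _ isOpen_Iio
  have h1 : (1 : Fin 4 → G) ∈ φ ⁻¹' Set.Iio η := by
    simp only [Set.mem_preimage, Set.mem_Iio, hφ, Pi.one_apply, inv_one, mul_one, map_one,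
      Matrix.trace_one, Fintype.card_fin, Complex.natCast_re, sub_self]
    exact hη
  obtain ⟨u, hu, hus⟩ := (isOpen_pi_iff'.1 hs) 1 h1
  refine ⟨⋂ k, u k, isOpen_iInter_of_finite fun k => (hu k).1, Set.mem_iInter.2 fun k => (hu k).2,
    fun a b c d ha hb hc hd => ?_⟩
  set g : Fin 4 → G := ![a, b, c, d] with hg
  have hgmem : g ∈ Set.univ.pi u := by
    intro k _
    fin_cases k
    · simpa [hg] using Set.mem_iInter.1 ha 0
    · simpa [hg] using Set.mem_iInter.1 hb 1
    · simpa [hg] using Set.mem_iInter.1 hc 2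
    · simpa [hg] using Set.mem_iInter.1 hd 3
  have hlt : φ g < η := hus hgmem
  simpa [hφ, hg] using hlt

variable [SecondCountableTopology G]

-- Below, `c_N := ∑ i, ∑ j, if i < j then N else 0 = Σ_{i<j} N` is the value of the corner action
-- density on flat configurations (written out; no definition is introduced).

omit [TopologicalSpace G] [IsTopologicalGroup G] [CompactSpace G] [MeasurableSpace G] [BorelSpace G]
  [SecondCountableTopology G] in
/-- `0 ≤ c_N`. [folklore] -/
theorem cN_nonneg (N : ℕ) : 0 ≤ (∑ i : Fin 4, ∑ j : Fin 4, if i < j then (N : ℝ) else 0) :=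
  Finset.sum_nonneg fun _ _ => Finset.sum_nonneg fun _ _ => by split_ifs <;> positivity

/-- Subtype sums over planes `i < j` versus double sums with an indicator. [folklore] -/
theorem sum_planes_eq (f : Fin 4 → Fin 4 → ℝ) :
    ∑ q : {p : Fin 4 × Fin 4 // p.1 < p.2}, f q.1.1 q.1.2 =
      ∑ i : Fin 4, ∑ j : Fin 4, if i < j then f i j else 0 := by
  rw [← Finset.sum_subtype (Finset.univ.filter fun p : Fin 4 × Fin 4 => p.1 < p.2) (by simp)
      (fun p : Fin 4 × Fin 4 => f p.1 p.2), Finset.sum_filter, ← Finset.univ_product_univ,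
    Finset.sum_product]

omit [TopologicalSpace G] [IsTopologicalGroup G] [CompactSpace G] [MeasurableSpace G] [BorelSpace G]
  [SecondCountableTopology G] in
/-- The corner deficit `c_N − P` is non-negative (`Re tr ρ ≤ N`). [folklore] -/
theorem cN_sub_actionDensity_nonneg (ρ : G →* Matrix (Fin N) (Fin N) ℂ)
    (hρN : ∀ g, (ρ g).trace.re ≤ N) (W : LGConfig 4 G) : 0 ≤ (∑ i : Fin 4, ∑ j : Fin 4, if i < j then (N : ℝ) else 0) - actionDensity ρ W := by
  unfold actionDensity
  rw [← Finset.sum_sub_distrib]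
  refine Finset.sum_nonneg fun i _ => ?_
  rw [← Finset.sum_sub_distrib]
  refine Finset.sum_nonneg fun j _ => ?_
  split_ifs
  · exact sub_nonneg.2 (hρN _)
  · simp

omit [TopologicalSpace G] [IsTopologicalGroup G] [CompactSpace G] [MeasurableSpace G] [BorelSpace G]
  [SecondCountableTopology G] in
/-- The corner deficit `c_N − P` is at most `2 c_N` (`Re tr ρ ≥ −N` for unitary `ρ`). [folklore] -/
theorem cN_sub_actionDensity_le (ρ : G →* Matrix (Fin N) (Fin N) ℂ)
    (hρN' : ∀ g, -(N : ℝ) ≤ (ρ g).trace.re) (W : LGConfig 4 G) :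
    (∑ i : Fin 4, ∑ j : Fin 4, if i < j then (N : ℝ) else 0) - actionDensity ρ W ≤ 2 * (∑ i : Fin 4, ∑ j : Fin 4, if i < j then (N : ℝ) else 0) := by
  have h : -(∑ i : Fin 4, ∑ j : Fin 4, if i < j then (N : ℝ) else 0) ≤ actionDensity ρ W := by
    unfold actionDensity
    rw [← Finset.sum_neg_distrib]
    refine Finset.sum_le_sum fun i _ => ?_
    rw [← Finset.sum_neg_distrib]
    refine Finset.sum_le_sum fun j _ => ?_
    split_ifs
    · exact hρN' _
    · simp
  linarith

/-- **Translation invariance: the mean action is `#sites` times the mean corner deficit.**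
`∫ S_W dμ_{β,S} = |Λ_S| · ∫ (c_N − P(Ũ)) dμ_{β,S}`, `P = actionDensity ρ`, `Ũ = torusLift S U`.
[folklore] -/
theorem integral_wilsonAction_eq_card_mul {S : ℕ} [NeZero S] (ρ : G →* Matrix (Fin N) (Fin N) ℂ)
    (hρ : Continuous ρ) (β : ℝ) :
    ∫ U, wilsonAction ρ U ∂(wilsonMeasure (d := 4) (L := S) ρ β) =
      Fintype.card (Site 4 S) *
        ∫ U, ((∑ i : Fin 4, ∑ j : Fin 4, if i < j then (N : ℝ) else 0) - actionDensity ρ (torusLift S U)) ∂(wilsonMeasure (d := 4) (L := S) ρ β) := by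
  set μ := wilsonMeasure (d := 4) (L := S) ρ β with hμ
  haveI := isProbabilityMeasure_wilsonMeasure (d := 4) (L := S) ρ hρ β
  -- integrability of single plaquette terms (bounded, measurable)
  obtain ⟨B, -, hB⟩ := exists_bound_trace_re_nonneg ρ hρ
  have hint : ∀ (x : Site 4 S) (i j : Fin 4), Integrable
      (fun U : GaugeConfig 4 S G => (N : ℝ) - (ρ (plaquetteHolonomy U x i j)).trace.re) μ := by
    intro x i j
    refine Integrable.of_bound ((measurable_const.sub ((continuous_trace_re ρ hρ).measurable.comp
      (measurable_plaquetteHolonomy x i j))).aestronglyMeasurable) ((N : ℝ) + B)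
      (ae_of_all _ fun U => ?_)
    rw [Real.norm_eq_abs]
    refine (abs_sub _ _).trans ?_
    rw [Nat.abs_cast]
    exact add_le_add le_rfl (hB _)
  -- each plaquette term has the same mean as the corresponding origin term of the lift
  have hterm : ∀ (x : Site 4 S) (i j : Fin 4),
      ∫ U, ((N : ℝ) - (ρ (plaquetteHolonomy U x i j)).trace.re) ∂μ =
        ∫ U, ((N : ℝ) - plaquetteObs ρ 0 i j (torusLift S U)) ∂μ := by
    intro x i j
    set y : Literature.Probability.LatticeModels.Site 4 := fun l => ((x l).val : ℤ) with hy
    have hxy : Literature.Probability.LatticeModels.Torus.proj S y = x := by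
      funext l
      simp [hy]
    have hhol : ∀ U : GaugeConfig 4 S G, plaquetteHolonomy U x i j =
        plaquetteHolonomyZd (configShift (-y) (torusLift S U)) 0 i j := fun U => by
      rw [plaquetteHolonomyZd_configShift, zero_sub, neg_neg, plaquetteHolonomyZd_torusLift', hxy]
    have h := integral_comp_configShift_torusLift (d := 4) (S := S) ρ β
      (fun W : LGConfig 4 G => (N : ℝ) - plaquetteObs ρ 0 i j W) (-y)
    simp only [plaquetteObs] at h ⊢
    simp only [hhol]
    exact h
  -- sum over plaquettes
  have hW : ∀ U : GaugeConfig 4 S G, wilsonAction ρ U =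
      ∑ x : Site 4 S, ∑ q : {p : Fin 4 × Fin 4 // p.1 < p.2},
        ((N : ℝ) - (ρ (plaquetteHolonomy U x q.1.1 q.1.2)).trace.re) := fun U => by
    unfold wilsonAction
    rw [← Finset.univ_product_univ, Finset.sum_product]
  simp_rw [hW]
  rw [integral_finsetSum _ fun x _ => integrable_finsetSum _ fun q _ => hint x q.1.1 q.1.2]
  have hx : ∀ x : Site 4 S, ∫ U, ∑ q : {p : Fin 4 × Fin 4 // p.1 < p.2},
      ((N : ℝ) - (ρ (plaquetteHolonomy U x q.1.1 q.1.2)).trace.re) ∂μ =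
        ∫ U, ((∑ i : Fin 4, ∑ j : Fin 4, if i < j then (N : ℝ) else 0) - actionDensity ρ (torusLift S U)) ∂μ := fun x => by
    rw [integral_finsetSum _ fun q _ => hint x q.1.1 q.1.2]
    simp_rw [hterm x]
    rw [← integral_finsetSum _ fun q _ => ?_]
    · refine integral_congr_ae (ae_of_all _ fun U => ?_)
      show ∑ q : {p : Fin 4 × Fin 4 // p.1 < p.2}, ((N : ℝ) - plaquetteObs ρ 0 q.1.1 q.1.2 (torusLift S U)) =
        (∑ i : Fin 4, ∑ j : Fin 4, if i < j then (N : ℝ) else 0) - actionDensity ρ (torusLift S U)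
      rw [sum_planes_eq (fun i j => (N : ℝ) - plaquetteObs ρ 0 i j (torusLift S U)), actionDensity,
        ← Finset.sum_sub_distrib]
      refine Finset.sum_congr rfl fun i _ => ?_
      rw [← Finset.sum_sub_distrib]
      refine Finset.sum_congr rfl fun j _ => ?_
      split_ifs <;> simp
    · have h := hint x q.1.1 q.1.2
      have hxy := hterm x q.1.1 q.1.2
      -- integrability of the origin term: same bound
      refine Integrable.of_bound ?_ ((N : ℝ) + B) (ae_of_all _ fun U => ?_)
      · exact (measurable_const.sub ((continuous_trace_re ρ hρ).measurable.comp
          ((measurable_plaquetteHolonomyZd_zero q.1.1 q.1.2).comp (measurable_torusLift S)))).aestronglyMeasurable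
      · rw [Real.norm_eq_abs]
        refine (abs_sub _ _).trans ?_
        rw [Nat.abs_cast]
        exact add_le_add le_rfl (hB _)
  simp_rw [hx]
  rw [Finset.sum_const, Finset.card_univ, nsmul_eq_mul]

end Torus

end Summit.QuantumFields.YangMills.Theorems.TunedSequenceExists.UniformFreezing

end
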